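import Literature.NumberTheory.Automorphic.Liu2021.CheckOfChiGalConj
import Literature.NumberTheory.Automorphic.ConjugateSymplecticOrthogonalTwist
import HarnessLib

/-!
# `χ̌` as a unitary idèle-class character is conjugate-ORTHOGONAL of ∞-type `0` — the instance feeding the twist lemmas

[Liu2021, App. D §D.1 (l. 5224)]: `χ̌(x) = χ(x_f/x_fᶜ)`, so `χ̌|_{𝔸_F^×} = 1` (conjugate orthogonal, Def. 4.1 l. 1900–1902) and `χ̌_∞ = 1`;
[Lem. D.1 (4) (l. 5235)]: the companion label `μᶜ·χ̌`.  Sequel of ★ `CheckOfChi` ∕ ★ `CheckOfChiGalConj` (A-p01: `checkOfChi_ideleBaseChange`,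
`checkOfChi_infiniteIdeles`, `galConj_checkOfChi`, and the §2 `…_iff_of_toHeckeCharacter_eq` transport) and of ★ `ConjugateSymplecticOrthogonalTwist`
(`IsConjugateSymplectic.mul_isConjugateOrthogonal_spec`).  THEOREMS ONLY; count-neutral; orientation-neutral (both companions covered).

For a CM field `L` and a unitary idèle-class character `η : C_L →ₜ* S¹` with `toHeckeCharacter L η = χ̌` (such `η` exists, ★
`HarrisKudlaSweet1996.exists_toHeckeCharacter_eq_of_isUnitary`; no `def` is introduced here):
* `toHeckeCharacter_one` ∕ `toHeckeCharacter_inv`, `infinityTypeChar_zero` ∕ `infinityTypeChar_neg`, `hasInfinityType_one_zero`,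
  `HasInfinityType.inv`, `isConjugateOrthogonal_one`, `IsConjugateOrthogonal.inv` — plumbing for the trivial and inverse characters;
* **`isConjugateOrthogonal_of_toHeckeCharacter_eq_checkOfChi`**, **`hasInfinityType_zero_of_toHeckeCharacter_eq_checkOfChi`** — `η` is conjugate
  orthogonal and has ∞-type `0` (★ §2 of `CheckOfChiGalConj` at `μ := 1`);
* the same for `η′` with `toHeckeCharacter L η′ = χ̌⁻¹ = galConj c χ̌` (`…_checkOfChi_inv`), and the packaged companions
  **`companion_spec_of_toHeckeCharacter_eq_checkOfChi`**: for `ψ` conjugate-symplectic of weight `𝔴`, `ψ·η` is conjugate-symplectic of weight `𝔴`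
  with `cmType = hψ.cmType` (★ `mul_isConjugateOrthogonal_spec`).

Consumer: d6 line census `CENSUS-S1b-CaseB-relabel` row 1 (closing it by name).  HC_CM is proved only modulo the 7 printed citations until rung 0
closes; this file proves no cell binder.

## References
* [Liu2021] Y. Liu, Camb. J. Math. 9 (2021) = arXiv:2102.11518: Def. 4.1 (l. 1900–1902), Def. 4.3, App. D §D.1 (l. 5224), Lem. D.1 (4) (l. 5235).
-/

set_option autoImplicit false

noncomputable section

open NumberField

namespace Literature.NumberTheory.Automorphic.IdeleClassGroup

open Literature.NumberTheory.GaloisRepresentations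
open Literature.NumberTheory.Automorphic.Liu2021 Literature.NumberTheory.Automorphic.Liu2021.Def411WeilCarriers
open Literature.NumberTheory.Automorphic.Liu2021.CheckOfChi

section Trivial

variable {K : Type} [Field K] [NumberField K]

/-- `toHeckeCharacter 1 = 1`. [folklore] [cite: Liu2021, Def. 4.1 (l. 1900–1902)] -/
theorem toHeckeCharacter_one : toHeckeCharacter K (1 : IdeleClassGroup K →ₜ* Circle) = 1 :=
  HeckeCharacter.ext fun _ => Units.ext rfl

/-- `toHeckeCharacter η⁻¹ = (toHeckeCharacter η)⁻¹` (with ★ `toHeckeCharacter_mul`). [folklore] [cite: Liu2021, Def. 4.1 (l. 1900–1902)] -/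
theorem toHeckeCharacter_inv (η : IdeleClassGroup K →ₜ* Circle) : toHeckeCharacter K η⁻¹ = (toHeckeCharacter K η)⁻¹ :=
  eq_inv_of_mul_eq_one_left (by rw [← toHeckeCharacter_mul, inv_mul_cancel, toHeckeCharacter_one])

/-- The ∞-type character of type `0` is trivial. [folklore] [cite: Liu2021, Def. 4.3] -/
theorem infinityTypeChar_zero : infinityTypeChar K 0 = 1 := by
  ext u
  rw [infinityTypeChar_apply]
  simp

/-- `infinityTypeChar (-e) = (infinityTypeChar e)⁻¹`. [folklore] [cite: Liu2021, Def. 4.3] -/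
theorem infinityTypeChar_neg (e : InfinitePlace K → ℤ) : infinityTypeChar K (-e) = (infinityTypeChar K e)⁻¹ :=
  eq_inv_of_mul_eq_one_left (by rw [← infinityTypeChar_add, neg_add_cancel, infinityTypeChar_zero])

/-- The trivial character has ∞-type `0`. [folklore] [cite: Liu2021, Def. 4.3] -/
theorem hasInfinityType_one_zero : HasInfinityType K (1 : IdeleClassGroup K →ₜ* Circle) 0 := fun u => by
  rw [infinityTypeChar_zero]
  rfl

/-- ∞-types negate under inversion: `η⁻¹` has ∞-type `-e`. [folklore] [cite: Liu2021, Def. 4.3] -/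
theorem HasInfinityType.inv {η : IdeleClassGroup K →ₜ* Circle} {e : InfinitePlace K → ℤ} (h : HasInfinityType K η e) :
    HasInfinityType K η⁻¹ (-e) := fun u => by
  rw [infinityTypeChar_neg, MonoidHom.inv_apply, ← h u]
  rfl

end Trivial

variable {L : Type} [Field L] [NumberField L] [IsCMField L]

omit [IsCMField L] in
/-- The trivial character is conjugate orthogonal. [folklore] [cite: Liu2021, Def. 4.1 (l. 1900–1902)] -/
theorem isConjugateOrthogonal_one : IsConjugateOrthogonal L (1 : IdeleClassGroup L →ₜ* Circle) := fun _ => rfl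

omit [IsCMField L] in
/-- Conjugate orthogonality passes to the inverse character. [folklore] [cite: Liu2021, Def. 4.1 (l. 1900–1902)] -/
theorem IsConjugateOrthogonal.inv {η : IdeleClassGroup L →ₜ* Circle} (h : IsConjugateOrthogonal L η) :
    IsConjugateOrthogonal L η⁻¹ := fun a => by
  change (η _)⁻¹ = 1
  rw [h a, inv_one]

variable (hcc : IsCMField.complexConj L * IsCMField.complexConj L = 1)
  (χ : Chi ↥(maximalRealSubfield L) L (IsCMField.complexConj L)) {η : IdeleClassGroup L →ₜ* Circle}

/-- **`χ̌` is conjugate orthogonal**: a unitary idèle-class character `η` with `toHeckeCharacter η = χ̌` is trivial on the base classes of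
`C_{L⁺}` (`χ̌|_{𝕀_{L⁺}} = 1`, ★ `checkOfChi_ideleBaseChange` through ★ `isConjugateOrthogonal_iff_of_toHeckeCharacter_eq` at `μ := 1`).
[cite: Liu2021, Def. 4.1 (l. 1900–1902); App. D §D.1 (l. 5224)] -/
theorem isConjugateOrthogonal_of_toHeckeCharacter_eq_checkOfChi (h : toHeckeCharacter L η = HeckeCharacter.checkOfChi hcc χ) :
    IsConjugateOrthogonal L η :=
  (isConjugateOrthogonal_iff_of_toHeckeCharacter_eq hcc χ (μ := 1) (μ' := η) (by rw [h, toHeckeCharacter_one, one_mul])).2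
    isConjugateOrthogonal_one

/-- **`χ̌` has ∞-type `0`** (`χ̌_∞ = 1`, ★ `checkOfChi_infiniteIdeles` through ★ `hasInfinityType_iff_of_toHeckeCharacter_eq` at `μ := 1`).
[cite: Liu2021, App. D §D.1 (l. 5224); Def. 4.3] -/
theorem hasInfinityType_zero_of_toHeckeCharacter_eq_checkOfChi (h : toHeckeCharacter L η = HeckeCharacter.checkOfChi hcc χ) :
    HasInfinityType L η 0 :=
  (hasInfinityType_iff_of_toHeckeCharacter_eq hcc χ (μ := 1) (μ' := η) (by rw [h, toHeckeCharacter_one, one_mul]) 0).2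
    hasInfinityType_one_zero

/-- The same for `χ̌⁻¹` (`= χ̌ᶜ`, ★ `galConj_checkOfChi`): `η′` with `toHeckeCharacter η′ = χ̌⁻¹` is conjugate orthogonal of ∞-type `0`
(apply the previous two statements to `η′⁻¹`). [cite: Liu2021, Def. 4.1 (l. 1900–1902); Lem. D.1 (4) (l. 5235)] -/
theorem isConjugateOrthogonal_and_hasInfinityType_zero_of_toHeckeCharacter_eq_checkOfChi_inv {η' : IdeleClassGroup L →ₜ* Circle}
    (h : toHeckeCharacter L η' = (HeckeCharacter.checkOfChi hcc χ)⁻¹) :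
    IsConjugateOrthogonal L η' ∧ HasInfinityType L η' 0 := by
  have h' : toHeckeCharacter L η'⁻¹ = HeckeCharacter.checkOfChi hcc χ := by rw [toHeckeCharacter_inv, h, inv_inv]
  have hO := (isConjugateOrthogonal_of_toHeckeCharacter_eq_checkOfChi hcc χ h').inv
  have hT := (hasInfinityType_zero_of_toHeckeCharacter_eq_checkOfChi hcc χ h').inv
  rw [inv_inv] at hO hT
  rw [neg_zero] at hT
  exact ⟨hO, hT⟩

/-- **Both companions at once**: for `ψ` conjugate-symplectic of weight `𝔴` and `η` with `toHeckeCharacter η = χ̌`, the twist `ψ·η` is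
conjugate-symplectic of weight `𝔴` with the SAME CM type (★ `mul_isConjugateOrthogonal_spec`; with `ψ := μᶜ` and ★ `cmType_galConj` this is
the companion `μᶜ·χ̌` of CM type `Φ̄_μ`). [cite: Liu2021, Def. 4.3; Lem. D.1 (4) (l. 5235); Thm. D.6 (1) (l. 5436)] -/
theorem companion_spec_of_toHeckeCharacter_eq_checkOfChi (h : toHeckeCharacter L η = HeckeCharacter.checkOfChi hcc χ)
    {ψ : IdeleClassGroup L →ₜ* Circle} (hψ : IsConjugateSymplectic L ψ) {𝔴 : InfinitePlace L → ℕ} (hw : HasWeight L ψ 𝔴) :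
    ∃ hc : IsConjugateSymplectic L (ψ * η), HasWeight L (ψ * η) 𝔴 ∧ hc.cmType = hψ.cmType :=
  hψ.mul_isConjugateOrthogonal_spec (isConjugateOrthogonal_of_toHeckeCharacter_eq_checkOfChi hcc χ h)
    (hasInfinityType_zero_of_toHeckeCharacter_eq_checkOfChi hcc χ h) hw

/-- … and for `η′` with `toHeckeCharacter η′ = χ̌⁻¹` (the companion `μ·χ̌ᶜ` of the other column). [cite: Liu2021, Def. 4.3; Lem. D.1 (4) (l. 5235)] -/
theorem companion_spec_of_toHeckeCharacter_eq_checkOfChi_inv {η' : IdeleClassGroup L →ₜ* Circle}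
    (h : toHeckeCharacter L η' = (HeckeCharacter.checkOfChi hcc χ)⁻¹)
    {ψ : IdeleClassGroup L →ₜ* Circle} (hψ : IsConjugateSymplectic L ψ) {𝔴 : InfinitePlace L → ℕ} (hw : HasWeight L ψ 𝔴) :
    ∃ hc : IsConjugateSymplectic L (ψ * η'), HasWeight L (ψ * η') 𝔴 ∧ hc.cmType = hψ.cmType :=
  have h2 := isConjugateOrthogonal_and_hasInfinityType_zero_of_toHeckeCharacter_eq_checkOfChi_inv hcc χ h
  hψ.mul_isConjugateOrthogonal_spec h2.1 h2.2 hw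

end Literature.NumberTheory.Automorphic.IdeleClassGroup

end
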